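import Mathlib.GroupTheory.Index
import Summits.MatrixMultiplication.OmegaCensus.BoxBadCommutingPairs

/-!
# ω-census, family (b3): conjecture C9 (b) HOLDS for every finite group with `|G′| ≤ 2`

HONEST FRAMING (pub-omega census; verbatim): lottery ticket; floor = certified bounds/negative ranges.
Census BOOKKEEPING (conjecture C9 of the cell, STRUCTURE.md §2; pub-omega kernel-l4 gen 15, task K-4).  Sequel of
`BoxBadCommutingPairs` (two commuting pairs with a common central involution commutator ⇒ not box-useful).  Here the hypothesis is
intrinsic: every commutator of `G` is `1` or a fixed element `c` (`|G′| ≤ 2`; then `c` is a central involution).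
* `central_of_comm`, `sq_of_comm`: `c` is central and `c² = 1`;
* **`centralizer_comm_of_boxUseful`**: if `G` is box-useful then the joint centraliser of any non-commuting pair `x₁, y₁` is
  ABELIAN (otherwise it contains the second pair of `CommPairs.not_boxUseful_of_two_pairs`);
* **`mem_center_of_mem_centralizer`**: that joint centraliser is then CENTRAL (every `h ∈ G` is `s k` with `s ∈ {1, x₁, y₁, x₁y₁}` and
  `k` in the centraliser, read off from the pair of commutators `([h,x₁], [h,y₁]) ∈ {1,c}²`);
* **`index_center_le_four_of_boxUseful`**: hence `[G : Z(G)] ≤ 4` — C9 (b) («box-useful ⇒ centre index `1`, `4`, `6` or `𝒞₂`») on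
  the whole class `|G′| ≤ 2`, which contains infinitely many minimal bad `2`-groups (`2^{1+2k}_±`, `D₈ ∘ M_{2^n}`, …) and on which the
  `p = 2` analysis of `BoxBadOddPGroups` (type I) needed one pattern per family.  Classification-free, `decide`-free.
Nothing here is progress on `ω`.
-/

namespace Summit.MatrixMultiplication.OmegaCensus

open Finset ProductBoxBound

namespace CommPairs

variable {G : Type*} [Group G] {c : G}

/-- If every commutator is `1` or `c` and `c` occurs, then `c` is central. [folklore] -/
theorem central_of_comm (hcomm : ∀ a b : G, a * b * a⁻¹ * b⁻¹ = 1 ∨ a * b * a⁻¹ * b⁻¹ = c) {x y : G}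
    (h : x * y * x⁻¹ * y⁻¹ = c) (hc1 : c ≠ 1) : c ∈ Subgroup.center G := by
  rw [Subgroup.mem_center_iff]
  intro g
  have key : (g * x * g⁻¹) * (g * y * g⁻¹) * (g * x * g⁻¹)⁻¹ * (g * y * g⁻¹)⁻¹ = g * c * g⁻¹ := by rw [← h]; group
  rcases hcomm (g * x * g⁻¹) (g * y * g⁻¹) with e | e
  · rw [key] at e
    exact absurd (by calc c = g⁻¹ * (g * c * g⁻¹) * g := by group
                          _ = 1 := by rw [e]; group) hc1
  · rw [key] at e
    calc g * c = g * c * g⁻¹ * g := by group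
      _ = c * g := by rw [e]

/-- If every commutator is `1` or `c` and `c` occurs, then `c² = 1`. [folklore] -/
theorem sq_of_comm (hcomm : ∀ a b : G, a * b * a⁻¹ * b⁻¹ = 1 ∨ a * b * a⁻¹ * b⁻¹ = c) {x y : G}
    (h : x * y * x⁻¹ * y⁻¹ = c) (hc1 : c ≠ 1) : c * c = 1 := by
  have key : y * x * y⁻¹ * x⁻¹ = c⁻¹ := by rw [← h]; group
  rcases hcomm y x with e | e
  · rw [key, inv_eq_one] at e; exact absurd e hc1
  · rw [key] at e
    calc c * c = c⁻¹ * c := by rw [e]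
      _ = 1 := by group

/-- **Box-useful with `|G′| ≤ 2` ⇒ joint centralisers of non-commuting pairs are abelian.** [folklore] -/
theorem centralizer_comm_of_boxUseful [Fintype G] [DecidableEq G] (hcomm : ∀ a b : G, a * b * a⁻¹ * b⁻¹ = 1 ∨ a * b * a⁻¹ * b⁻¹ = c)
    (hG : BoxUseful G) {x₁ y₁ : G} (h1 : x₁ * y₁ ≠ y₁ * x₁) {x₂ y₂ : G}
    (hxx : x₁ * x₂ = x₂ * x₁) (hxy : x₁ * y₂ = y₂ * x₁) (hyx : y₁ * x₂ = x₂ * y₁) (hyy : y₁ * y₂ = y₂ * y₁) :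
    x₂ * y₂ = y₂ * x₂ := by
  by_contra h2
  have hc : x₁ * y₁ * x₁⁻¹ * y₁⁻¹ = c := (hcomm x₁ y₁).resolve_left fun e => h1 (by
    calc x₁ * y₁ = x₁ * y₁ * x₁⁻¹ * y₁⁻¹ * (y₁ * x₁) := by group
      _ = y₁ * x₁ := by rw [e, one_mul])
  have hc' : x₂ * y₂ * x₂⁻¹ * y₂⁻¹ = c := (hcomm x₂ y₂).resolve_left fun e => h2 (by
    calc x₂ * y₂ = x₂ * y₂ * x₂⁻¹ * y₂⁻¹ * (y₂ * x₂) := by group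
      _ = y₂ * x₂ := by rw [e, one_mul])
  have hc1 : c ≠ 1 := by
    rintro rfl; apply h1
    calc x₁ * y₁ = x₁ * y₁ * x₁⁻¹ * y₁⁻¹ * (y₁ * x₁) := by group
      _ = y₁ * x₁ := by rw [hc, one_mul]
  exact not_boxUseful_of_two_pairs hc hc' hxx hxy hyx hyy (central_of_comm hcomm hc hc1) hc1 (sq_of_comm hcomm hc hc1) hG

/-- The commutator of a product: `[a k, x] = [a, x]` when `k` commutes with `x`. [folklore] -/
theorem comm_mul_of_commute {a k x : G} (hk : k * x = x * k) : a * k * x * (a * k)⁻¹ * x⁻¹ = a * x * a⁻¹ * x⁻¹ := by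
  calc a * k * x * (a * k)⁻¹ * x⁻¹ = a * (k * x) * k⁻¹ * a⁻¹ * x⁻¹ := by group
    _ = a * (x * k) * k⁻¹ * a⁻¹ * x⁻¹ := by rw [hk]
    _ = a * x * a⁻¹ * x⁻¹ := by group

/-- Two elements with the same commutators against `x` differ by an element commuting with `x`. [folklore] -/
theorem commute_of_comm_eq {a b x : G} (h : a * x * a⁻¹ * x⁻¹ = b * x * b⁻¹ * x⁻¹) : (a⁻¹ * b) * x = x * (a⁻¹ * b) := by
  have e : a * x * a⁻¹ = b * x * b⁻¹ := mul_right_cancel h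
  calc a⁻¹ * b * x = a⁻¹ * (b * x * b⁻¹) * b := by group
    _ = a⁻¹ * (a * x * a⁻¹) * b := by rw [e]
    _ = x * (a⁻¹ * b) := by group

/-- **With `|G′| ≤ 2`, an element commuting with a non-commuting pair `x₁, y₁` and with their joint centraliser is central**:
every `h` is `s k` with `s ∈ {1, x₁, y₁, x₁y₁}` and `k` centralising `x₁, y₁`. [folklore] -/
theorem mem_center_of_centralizer (hcomm : ∀ a b : G, a * b * a⁻¹ * b⁻¹ = 1 ∨ a * b * a⁻¹ * b⁻¹ = c) {x₁ y₁ : G}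
    (h1 : x₁ * y₁ * x₁⁻¹ * y₁⁻¹ = c) (hc1 : c ≠ 1) {g : G} (hgx : g * x₁ = x₁ * g) (hgy : g * y₁ = y₁ * g)
    (hgC : ∀ k : G, k * x₁ = x₁ * k → k * y₁ = y₁ * k → g * k = k * g) : g ∈ Subgroup.center G := by
  have cc : ∀ t : G, t * c = c * t := fun t => Subgroup.mem_center_iff.mp (central_of_comm hcomm h1 hc1) t
  have hcinv : c⁻¹ = c := by rw [inv_eq_iff_mul_eq_one, sq_of_comm hcomm h1 hc1]
  have ψyx : y₁ * x₁ * y₁⁻¹ * x₁⁻¹ = c := by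
    calc y₁ * x₁ * y₁⁻¹ * x₁⁻¹ = (x₁ * y₁ * x₁⁻¹ * y₁⁻¹)⁻¹ := by group
      _ = c := by rw [h1, hcinv]
  have ψpx : x₁ * y₁ * x₁ * (x₁ * y₁)⁻¹ * x₁⁻¹ = c := by
    calc x₁ * y₁ * x₁ * (x₁ * y₁)⁻¹ * x₁⁻¹ = x₁ * (y₁ * x₁ * y₁⁻¹ * x₁⁻¹) * x₁⁻¹ := by group
      _ = c := by rw [ψyx, cc x₁]; group
  have ψpy : x₁ * y₁ * y₁ * (x₁ * y₁)⁻¹ * y₁⁻¹ = c := by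
    calc x₁ * y₁ * y₁ * (x₁ * y₁)⁻¹ * y₁⁻¹ = x₁ * y₁ * x₁⁻¹ * y₁⁻¹ := by group
      _ = c := h1
  have hgp : g * (x₁ * y₁) = x₁ * y₁ * g := by
    calc g * (x₁ * y₁) = (g * x₁) * y₁ := by group
      _ = (x₁ * g) * y₁ := by rw [hgx]
      _ = x₁ * (g * y₁) := by group
      _ = x₁ * (y₁ * g) := by rw [hgy]
      _ = x₁ * y₁ * g := by group
  rw [Subgroup.mem_center_iff]
  intro h
  -- `h = s k`: `s ∈ {1, x₁, y₁, x₁y₁}` with the same commutators as `h`, so `k = s⁻¹ h` centralises `x₁, y₁`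
  obtain ⟨s, hsg, hsx, hsy⟩ : ∃ s : G, g * s = s * g ∧ s * x₁ * s⁻¹ * x₁⁻¹ = h * x₁ * h⁻¹ * x₁⁻¹ ∧
      s * y₁ * s⁻¹ * y₁⁻¹ = h * y₁ * h⁻¹ * y₁⁻¹ := by
    rcases hcomm h x₁ with ex | ex <;> rcases hcomm h y₁ with ey | ey
    · exact ⟨1, by group, by rw [ex]; group, by rw [ey]; group⟩
    · exact ⟨x₁, hgx, by rw [ex]; group, by rw [ey]; exact h1⟩
    · exact ⟨y₁, hgy, by rw [ex]; exact ψyx, by rw [ey]; group⟩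
    · exact ⟨x₁ * y₁, hgp, by rw [ex]; exact ψpx, by rw [ey]; exact ψpy⟩
  have kx := commute_of_comm_eq hsx
  have ky := commute_of_comm_eq hsy
  have gk := hgC (s⁻¹ * h) kx ky
  calc h * g = s * ((s⁻¹ * h) * g) := by group
    _ = s * (g * (s⁻¹ * h)) := by rw [gk]
    _ = (s * g) * (s⁻¹ * h) := by group
    _ = (g * s) * (s⁻¹ * h) := by rw [hsg]
    _ = g * h := by group

/-- **C9 (b) for `|G′| ≤ 2`: a box-useful finite group all of whose commutators lie in `{1, c}` has centre of index at most `4`.**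
[folklore] -/
theorem index_center_le_four_of_boxUseful [Fintype G] [DecidableEq G]
    (hcomm : ∀ a b : G, a * b * a⁻¹ * b⁻¹ = 1 ∨ a * b * a⁻¹ * b⁻¹ = c) (hG : BoxUseful G) :
    (Subgroup.center G).index ≤ 4 := by
  classical
  by_cases hab : ∀ a b : G, a * b = b * a
  · have htop : Subgroup.center G = ⊤ := by
      rw [Subgroup.eq_top_iff']; intro x; rw [Subgroup.mem_center_iff]; intro g; exact hab g x
    rw [htop, Subgroup.index_top]; omega
  push Not at hab
  obtain ⟨x₁, y₁, h1ne⟩ := hab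
  have h1 : x₁ * y₁ * x₁⁻¹ * y₁⁻¹ = c := (hcomm x₁ y₁).resolve_left fun e => h1ne (by
    calc x₁ * y₁ = x₁ * y₁ * x₁⁻¹ * y₁⁻¹ * (y₁ * x₁) := by group
      _ = y₁ * x₁ := by rw [e, one_mul])
  have hc1 : c ≠ 1 := by
    rintro rfl; apply h1ne
    calc x₁ * y₁ = x₁ * y₁ * x₁⁻¹ * y₁⁻¹ * (y₁ * x₁) := by group
      _ = y₁ * x₁ := by rw [h1, one_mul]
  -- the joint centraliser `C` of `x₁, y₁` is central
  set C : Subgroup G := Subgroup.centralizer {x₁, y₁} with hCdef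
  have memC : ∀ k : G, k ∈ C ↔ k * x₁ = x₁ * k ∧ k * y₁ = y₁ * k := by
    intro k
    rw [hCdef, Subgroup.mem_centralizer_iff]
    constructor
    · intro hk; exact ⟨(hk x₁ (by simp)).symm, (hk y₁ (by simp)).symm⟩
    · rintro ⟨hx, hy⟩ z hz
      simp only [Set.mem_insert_iff, Set.mem_singleton_iff] at hz
      rcases hz with rfl | rfl
      · exact hx.symm
      · exact hy.symm
  have hCle : C ≤ Subgroup.center G := by
    intro g hg
    obtain ⟨hgx, hgy⟩ := (memC g).1 hg
    exact mem_center_of_centralizer hcomm h1 hc1 hgx hgy fun k kx ky =>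
      centralizer_comm_of_boxUseful hcomm hG h1ne hgx.symm kx.symm hgy.symm ky.symm
  -- `[G : C] ≤ 4`: the pair of commutators with `x₁, y₁` separates the cosets of `C`
  have hidx : C.index ≤ 4 := by
    let β : G → Bool × Bool := fun h => (decide (h * x₁ * h⁻¹ * x₁⁻¹ = 1), decide (h * y₁ * h⁻¹ * y₁⁻¹ = 1))
    have hβ : ∀ a b : G, a⁻¹ * b ∈ C → β a = β b := by
      intro a b hab
      obtain ⟨kx, ky⟩ := (memC _).1 hab
      have ea : b = a * (a⁻¹ * b) := by group
      have e1 : b * x₁ * b⁻¹ * x₁⁻¹ = a * x₁ * a⁻¹ * x₁⁻¹ := by rw [ea]; exact comm_mul_of_commute kx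
      have e2 : b * y₁ * b⁻¹ * y₁⁻¹ = a * y₁ * a⁻¹ * y₁⁻¹ := by rw [ea]; exact comm_mul_of_commute ky
      simp only [β, e1, e2]
    have val : ∀ {a b x : G}, decide (a * x * a⁻¹ * x⁻¹ = 1) = decide (b * x * b⁻¹ * x⁻¹ = 1) →
        a * x * a⁻¹ * x⁻¹ = b * x * b⁻¹ * x⁻¹ := by
      intro a b x e
      rcases hcomm a x with ha | ha <;> rcases hcomm b x with hb | hb
      · rw [ha, hb]
      · rw [ha, hb] at e; simp [hc1] at e
      · rw [ha, hb] at e; simp [hc1] at e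
      · rw [ha, hb]
    let ψ : G ⧸ C → Bool × Bool := Quotient.lift β fun a b hab => hβ a b (QuotientGroup.leftRel_apply.mp hab)
    have hψ : Function.Injective ψ := by
      intro p q
      induction p using QuotientGroup.induction_on with
      | H a =>
        induction q using QuotientGroup.induction_on with
        | H b =>
          intro e
          change β a = β b at e
          simp only [β, Prod.mk.injEq] at e
          apply QuotientGroup.eq.mpr
          exact (memC _).2 ⟨commute_of_comm_eq (val e.1), commute_of_comm_eq (val e.2)⟩
    rw [Subgroup.index_eq_card]
    calc Nat.card (G ⧸ C) ≤ Nat.card (Bool × Bool) := Nat.card_le_card_of_injective ψ hψ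
      _ = 4 := by simp
  have hdvd : (Subgroup.center G).index ∣ C.index := Subgroup.index_dvd_of_le hCle
  have hpos : 0 < C.index := Nat.pos_of_ne_zero C.index_ne_zero_of_finite
  exact (Nat.le_of_dvd hpos hdvd).trans hidx

end CommPairs

end Summit.MatrixMultiplication.OmegaCensus
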